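import Summits.SmoothPoincare4.SmoothPoincare4.Theorems.ConvexBisectionAcyclicBisectionExistsChartedChainCycle
import Summits.SmoothPoincare4.SmoothPoincare4.Theorems.ConvexBisectionAcyclicBisectionExistsBaseReflectionDeriv
import HarnessLib

/-!
# The charted vanishing cycle, II: orientation, and the six chart hypotheses of node N1a
(wave 4, brick Y4-2d of the model chain (R2) `exists_charted_chain` for the missing lemma
`crossingNumber_eq_stdSymp` of node N1a of stub `stub_modelsOnFibred_of_reach` = NF4, line
`modp-braid-orbits`, crux `ConvexBisection.AcyclicBisectionExists`, item stmt-SmoothPoincare4-10508;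
registered sub-goal `helper_cycleChart`)

Sequel of `…ChartedChainCycle.lean`.  The ambient chart `cycleAmb g c (u, r) = pagePt g c (jX t, jY t)`,
`t = radP g r · e^{2πiu}`, factors through the HOLOMORPHIC map `t ↦ (λ jX t, μ jY t)` of the
`t`-plane, so its partial derivatives are complex multiples of one vector:
`∂ᵤ = (P, Q) · 2πi t`, `∂ᵣ = (P, Q) · radP'(r) e^{2πiu}` with `P = λ jX'(t) ≠ 0`, `Q = μ jY'(t)`
(`hasDerivAt_cycleAmb_u/_r`), and the Kähler pairing of node N1a is
`⟪∂ᵣ, i ∂ᵤ⟫ = Im (a b̄)(|P|² + |Q|²) = −2π radP'(r) radP(r) (|P|² + |Q|²) > 0` (`inner_mk_mul`,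
`orient_cycleChart`) — positive exactly because the profile `radP` DECREASES.  Together with the
derivative-free clauses of the prequel this gives **`helper_cycleChart`**: the six annulus-chart
hypotheses of node N1a (smooth, `1`-periodic, cored by a circle map `b`, in `page g c`, injective on
`[0,1) × (−1,1)`, positively oriented) for `cycleChart`, for every `g ≥ 1` and `‖c‖ ≤ 1`.
Everything is proved; no `sorry`.  References: J. Milnor, *Singular points of complex
hypersurfaces* (1968), §9 [Milnor1968]; B. Farb, D. Margalit, *A primer on mapping class groups*
(2012), §6.1 [FarbMargalit2012].
-/

noncomputable section

set_option linter.dupNamespace false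

open scoped Manifold ContDiff Topology ComplexConjugate Real
open Set Function Metric Complex
open Literature.Topology.FourManifolds Literature.Topology.FourManifolds.LefschetzBase

namespace Summit.SmoothPoincare4.SmoothPoincare4.Theorems.AcyclicBisectionExists.ModpBraidOrbits

variable {g : ℕ} {c : ℂ}

/-! ## §1 The partial derivatives of the ambient chart -/

/-- A curve `s ↦ mk (A s) (B s)` has velocity `mk a' b'`. [folklore] -/
theorem hasDerivAt_mk_comp {A B : ℝ → ℂ} {a' b' : ℂ} {s : ℝ} (hA : HasDerivAt A a' s)
    (hB : HasDerivAt B b' s) : HasDerivAt (fun s' => mk (A s') (B s')) (mk a' b') s := by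
  have h := mkCLM.hasFDerivAt.comp_hasDerivAt s (hA.prodMk hB)
  exact h

/-- **`∂ᵤ` of the ambient chart**: `(λ jX'(t) · 2πi t, μ jY'(t) · 2πi t)`. [folklore] -/
theorem hasDerivAt_cycleAmb_u (hg : 1 ≤ g) (c : ℂ) (u r : ℝ) :
    HasDerivAt (fun u' => cycleAmb g c (u', r))
      (mk (scaleX g c * ((shalf g : ℂ) * I * ((1 - (tParam g (u, r) ^ 2)⁻¹) / 2)) *
            (tParam g (u, r) * (2 * π * I)))
          (scaleY c * deriv (jY g) (tParam g (u, r)) * (tParam g (u, r) * (2 * π * I)))) u := by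
  have hT := hasDerivAt_tParam_u g u r
  have hX := (hasDerivAt_jX g (tParam_ne_zero g (u, r))).comp u hT
  have hY := ((differentiableAt_jY g (tParam_ne_zero g (u, r)) (strip_tParam hg (u, r))).hasDerivAt).comp u hT
  have h := hasDerivAt_mk_comp (hX.const_mul (scaleX g c)) (hY.const_mul (scaleY c))
  refine h.congr_deriv ?_
  congr 1 <;> ring

/-- **`∂ᵣ` of the ambient chart**: `(λ jX'(t) · radP' e^{2πiu}, μ jY'(t) · radP' e^{2πiu})`. [folklore] -/
theorem hasDerivAt_cycleAmb_r (hg : 1 ≤ g) (c : ℂ) (u r : ℝ) :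
    HasDerivAt (fun r' => cycleAmb g c (u, r'))
      (mk (scaleX g c * ((shalf g : ℂ) * I * ((1 - (tParam g (u, r) ^ 2)⁻¹) / 2)) *
            (((deriv (radP g) r : ℝ) : ℂ) * Complex.exp (((2 * π * u : ℝ) : ℂ) * I)))
          (scaleY c * deriv (jY g) (tParam g (u, r)) *
            (((deriv (radP g) r : ℝ) : ℂ) * Complex.exp (((2 * π * u : ℝ) : ℂ) * I)))) r := by
  have hT := hasDerivAt_tParam_r g u r
  have hX := (hasDerivAt_jX g (tParam_ne_zero g (u, r))).comp r hT
  have hY := ((differentiableAt_jY g (tParam_ne_zero g (u, r)) (strip_tParam hg (u, r))).hasDerivAt).comp r hT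
  have h := hasDerivAt_mk_comp (hX.const_mul (scaleX g c)) (hY.const_mul (scaleY c))
  refine h.congr_deriv ?_
  congr 1 <;> ring

/-! ## §2 The Kähler pairing of two complex multiples of one vector -/

/-- **`⟪(P a, Q a), i (P b, Q b)⟫ = Im (a b̄) · (|P|² + |Q|²)`.** [folklore] -/
theorem inner_mk_mul (P Q a b : ℂ) :
    inner ℝ (mk (P * a) (Q * a)) (cplxJ (mk (P * b) (Q * b))) =
      (a * conj b).im * (Complex.normSq P + Complex.normSq Q) := by
  rw [inner_eq_re_herm, cx_cplxJ, cy_cplxJ, cx_mk, cy_mk, cx_mk, cy_mk]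
  simp only [map_mul, Complex.conj_I, Complex.add_re, Complex.mul_re, Complex.mul_im,
    Complex.conj_re, Complex.conj_im, Complex.neg_re, Complex.neg_im, Complex.I_re, Complex.I_im,
    Complex.normSq_apply]
  ring

/-- `e^{iθ} · conj e^{iθ} = 1`. [folklore] -/
theorem exp_mul_conj_exp (θ : ℝ) : Complex.exp (θ * I) * conj (Complex.exp (θ * I)) = 1 := by
  rw [Complex.mul_conj, Complex.normSq_eq_norm_sq, Complex.norm_exp_ofReal_mul_I]; norm_num

/-- The phase factor of the chart: `Im (ρ' e · conj (ρ e · 2πi)) = −2π ρ' ρ`. [folklore] -/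
theorem im_phase (ρ ρ' θ : ℝ) :
    ((ρ' : ℂ) * Complex.exp (θ * I) * conj ((ρ : ℂ) * Complex.exp (θ * I) * (2 * π * I))).im =
      -(2 * π * ρ' * ρ) := by
  have h := exp_mul_conj_exp θ
  have e : (ρ' : ℂ) * Complex.exp (θ * I) * conj ((ρ : ℂ) * Complex.exp (θ * I) * (2 * π * I)) =
      -(2 * π * ρ' * ρ : ℝ) * I * (Complex.exp (θ * I) * conj (Complex.exp (θ * I))) := by
    simp only [map_mul, Complex.conj_ofReal, Complex.conj_I]
    rw [map_ofNat]; push_cast; ring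
  rw [e, h, mul_one]
  simp

/-! ## §3 The chart is positively oriented -/

/-- **`0 < ⟪∂ᵣ, i ∂ᵤ⟫` on the open strip** (`radP' < 0` there, `λ jX'(t) ≠ 0`). [folklore] -/
theorem orient_cycleChart (hg : 1 ≤ g) (hc : ‖c‖ ≤ 1) (u r : ℝ) (hr : r ∈ Ioo (-1 : ℝ) 1) :
    0 < inner ℝ (deriv (fun r' => (cycleChart hg hc (u, r')).1) r)
      (cplxJ (deriv (fun u' => (cycleChart hg hc (u', r)).1) u)) := by
  simp only [cycleChart_val]
  rw [(hasDerivAt_cycleAmb_r hg c u r).deriv, (hasDerivAt_cycleAmb_u hg c u r).deriv, inner_mk_mul]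
  have hP : scaleX g c * ((shalf g : ℂ) * I * ((1 - (tParam g (u, r) ^ 2)⁻¹) / 2)) ≠ 0 :=
    mul_ne_zero (scaleX_ne_zero hc) (deriv_jX_ne_zero hg (one_lt_norm_tParam g (u, r)))
  have hPos := Complex.normSq_pos.2 hP
  have hQ := Complex.normSq_nonneg (scaleY c * deriv (jY g) (tParam g (u, r)))
  have hT : tParam g (u, r) = (radP g r : ℂ) * Complex.exp (((2 * π * u : ℝ) : ℂ) * I) := rfl
  rw [hT] at hPos hQ ⊢
  rw [im_phase]
  refine mul_pos ?_ (by linarith)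
  have h1 := deriv_radP_neg g hr
  have h2 := radP_pos g r
  nlinarith [Real.pi_pos, mul_pos Real.pi_pos (mul_pos (neg_pos.2 h1) h2)]

/-! ## §4 The registered form: the six chart hypotheses of node N1a -/

/-- **Sub-goal `helper_cycleChart`** (Y4-2 of the model chain (R2) for node N1a of NF4): for
`g ≥ 1` and `‖c‖ ≤ 1` the annulus chart `cycleChart` of the vanishing cycle of `page g c` over the
symmetric chord `[ζ_{2g}, ζ_0]` satisfies the six chart hypotheses of node N1a — smooth into the
base, `1`-periodic, cored by a continuous circle map `b`, with values in `page g c`, injective on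
`[0,1) × (−1,1)`, and positively oriented (`0 < ⟪∂ᵣ, i ∂ᵤ⟫`). [cite: Milnor1968, §9] -/
theorem helper_cycleChart : ∀ (g : ℕ) (c : ℂ) (hg : 1 ≤ g) (hc : ‖c‖ ≤ 1), ∃ b : Metric.sphere (0 : EuclideanSpace ℝ (Fin 2)) 1 → Literature.Topology.FourManifolds.LefschetzBase.Base g, Continuous b ∧ ContMDiff 𝓘(ℝ, ℝ × ℝ) (𝓡∂ 4) ∞ (Summit.SmoothPoincare4.SmoothPoincare4.Theorems.AcyclicBisectionExists.ModpBraidOrbits.cycleChart hg hc) ∧ (∀ u r, Summit.SmoothPoincare4.SmoothPoincare4.Theorems.AcyclicBisectionExists.ModpBraidOrbits.cycleChart hg hc (u + 1, r) = Summit.SmoothPoincare4.SmoothPoincare4.Theorems.AcyclicBisectionExists.ModpBraidOrbits.cycleChart hg hc (u, r)) ∧ (∀ u, Summit.SmoothPoincare4.SmoothPoincare4.Theorems.AcyclicBisectionExists.ModpBraidOrbits.cycleChart hg hc (u, 0) = b (Literature.Topology.FourManifolds.circlePt u)) ∧ (∀ p, Summit.SmoothPoincare4.SmoothPoincare4.Theorems.AcyclicBisectionExists.ModpBraidOrbits.cycleChart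 hg hc p ∈ Literature.Topology.FourManifolds.LefschetzBase.page g c) ∧ Set.InjOn (Summit.SmoothPoincare4.SmoothPoincare4.Theorems.AcyclicBisectionExists.ModpBraidOrbits.cycleChart hg hc) (Set.Ico (0 : ℝ) 1 ×ˢ Set.Ioo (-1 : ℝ) 1) ∧ (∀ u r, r ∈ Set.Ioo (-1 : ℝ) 1 → 0 < inner ℝ (deriv (fun r' => (Summit.SmoothPoincare4.SmoothPoincare4.Theorems.AcyclicBisectionExists.ModpBraidOrbits.cycleChart hg hc (u, r')).1) r) (Literature.Topology.FourManifolds.LefschetzBase.cplxJ (deriv (fun u' => (Summit.SmoothPoincare4.SmoothPoincare4.Theorems.AcyclicBisectionExists.ModpBraidOrbits.cycleChart hg hc (u', r)).1) u))) := by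
  intro g c hg hc
  obtain ⟨b, hb, hbu⟩ := exists_cycleCore hg hc
  exact ⟨b, hb, contMDiff_cycleChart hg hc, cycleChart_periodic hg hc, hbu, cycleChart_mem_page hg hc,
    cycleChart_injOn hg hc, orient_cycleChart hg hc⟩

end Summit.SmoothPoincare4.SmoothPoincare4.Theorems.AcyclicBisectionExists.ModpBraidOrbits

end
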